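import Summits.BirchSwinnertonDyer.BirchSwinnertonDyer.Theorems.ClassRecordThreeEulerHalvesAtThreeResidualUpperBoundCartanPlaceTwistLaw
import Summits.BirchSwinnertonDyer.BirchSwinnertonDyer.Theorems.RamifiedHeegnerPairLeafOffHabitatAtlas
import Literature.NumberTheory.EllipticCurves.OggFormulaTameTypesTwoProofs
import Literature.NumberTheory.Automorphic.CDTSwanConductorProofs
import Literature.NumberTheory.EllipticCurves.TamagawaRingEquivProofs
import HarnessLib

/-!
# Route `RamifiedHeegnerPair`, crux U₁ `LeafRankOneUpperAtThree` (stmt-BirchSwinnertonDyer-26022) — atlas region R2 is EMPTY: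
# a Tamagawa-`3` carrier at `2` is TAME (`8 ∤ N`), UNCONDITIONALLY

HONEST FRAMING. Theorems only; helper file (`--supports stmt-BirchSwinnertonDyer-26022 --as helper`); no definition, no named fact, no
`sorry`; UNCONDITIONAL (Ogg–Saito at `2`, Tate's algorithm); nothing booked; BSD is proved for no curve. Landed by the LEAD prover
bsd-line-rhp-p2 g55 (2026-08-30) FROM THE PROOF OF crux-ideate seat 2 gen 7 (`Cruxes/LeafRankOneUpperAtThree/Lines/tameatlas.lean`,
§(R2∅), planner-cruxidea-stmt-BirchSwinnertonDyer-26022-2-g7, 15:42Z) so that every line of the crux can IMPORT it: the off-habitat atlas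
(p774819) leaves `TwoMultCarriers ∨ WildTwoCarrier`; this file kills the second alternative for EVERY elliptic curve over `ℚ`.
-- adapted from Summits/BirchSwinnertonDyer/BirchSwinnertonDyer/Cruxes/LeafRankOneUpperAtThree/Lines/tameatlas.lean (§(R2∅), verbatim; predicate unfolded)

* `eight_dvd_conductorNorm_iff_wildConductorExponent_ne_zero` — `8 ∣ N_E` iff the wild exponent at `2` is non-zero.
* `not_eight_dvd_and_three_dvd_localTamagawaNumber_two` — `¬ (2³ ∣ N_E ∧ 3 ∣ c₂(E))`: additive at `2` with `3 ∣ c₂` means Kodaira IV or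
  IV* (`CartanPlaceTwistLaw.kodairaSymbolAt_IV_or_IVstar_of_additive_of_three_dvd`), whose wild exponent vanishes
  (`wildConductorExponent_eq_zero_of_kodairaSymbolAt_IV_or_IVstar_two`); non-additive at `2` means `f₂ ≤ 1`.

References: [cite: SilvermanATAEC1994, IV.9.4 Steps 5 and 8, Table 4.1; Thm. IV.11.1] [cite: Ogg1967, Thm. 2]. presearch: n/a (kernel bookkeeping
over tree theorems; the statement is the crux-ideate seat's, credited above).
-/

-- D-0017: single-problem summit, so `Summit.BirchSwinnertonDyer.BirchSwinnertonDyer.…` repeats a namespace BY DESIGN.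
set_option linter.dupNamespace false
set_option autoImplicit false

noncomputable section

open scoped Classical NumberField

open WeierstrassCurve NumberField IsDedekindDomain Literature Literature.NumberTheory.EllipticCurves
  Rat.HeightOneSpectrum IsDedekindDomain.HeightOneSpectrum
  Literature.NumberTheory.EllipticCurves.Rank1Residual
  Literature.NumberTheory.DiophantineGeometry
  Summit.BirchSwinnertonDyer.Rank1Residual
  Summit.BirchSwinnertonDyer.Rank1Residual.Additive
  Summit.BirchSwinnertonDyer.BirchSwinnertonDyer.Theorems

namespace Summit.BirchSwinnertonDyer.BirchSwinnertonDyer.Theorems.LeafNotWildTwoCarrier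

/-- `8 ∣ N_E` iff the wild conductor exponent at the place of `𝓞 ℚ` above `2` is non-zero (the tree's
`three_le_conductorExponent_iff_wildConductorExponent_ne_zero` at `2`, Ogg–Saito). [cite: SilvermanATAEC1994, Thm. IV.11.1] -/
theorem eight_dvd_conductorNorm_iff_wildConductorExponent_ne_zero (W : WeierstrassCurve ℚ) [W.IsElliptic] :
    8 ∣ W.conductorNorm ℤ ↔
      W.wildConductorExponent ((primesEquiv (R := 𝓞 ℚ)).symm ⟨2, Nat.prime_two⟩) ≠ 0 := by
  set v : HeightOneSpectrum (𝓞 ℚ) := (primesEquiv (R := 𝓞 ℚ)).symm ⟨2, Nat.prime_two⟩ with hv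
  set vZ : HeightOneSpectrum ℤ := (primesEquiv (R := ℤ)).symm ⟨2, Nat.prime_two⟩ with hvZ
  haveI := perfectField_residueField_adicCompletionIntegers (K := ℚ) v
  rw [← W.three_le_conductorExponent_iff_wildConductorExponent_ne_zero v,
    conductorExponent_ringOfIntegers_eq W v, hv, Equiv.apply_symm_apply, ← hvZ]
  have hfac := factorization_conductorNorm_holds W vZ
  have hgen : natGenerator vZ = 2 := by
    change ((primesEquiv vZ : Nat.Primes) : ℕ) = 2
    rw [hvZ, Equiv.apply_symm_apply]
  rw [hgen] at hfac
  rw [← hfac, ← Nat.Prime.pow_dvd_iff_le_factorization Nat.prime_two (conductorNorm_pos_holds W).ne']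
  norm_num

/-- **A Tamagawa-`3` carrier at `2` is TAME: `¬ (2³ ∣ N_E ∧ 3 ∣ c₂(E))` for every elliptic `W/ℚ`** (= `¬ WildTwoCarrier W` of the
crux's workfiles, predicate unfolded). If `W` is additive at `2` with `3 ∣ c₂` its Kodaira type is IV or IV*
(`CartanPlaceTwistLaw.kodairaSymbolAt_IV_or_IVstar_of_additive_of_three_dvd`), and those types have wild exponent `0`
(`wildConductorExponent_eq_zero_of_kodairaSymbolAt_IV_or_IVstar_two`); if `W` is not additive at `2` then `f₂ ≤ 1`. Either way `8 ∤ N`.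
[cite: SilvermanATAEC1994, IV.9.4 Steps 5 and 8, Table 4.1; Thm. IV.11.1] -/
theorem not_eight_dvd_and_three_dvd_localTamagawaNumber_two (W : WeierstrassCurve ℚ) [W.IsElliptic] :
    ¬ (2 ^ 3 ∣ W.conductorNorm ℤ ∧ 3 ∣ (W.baseChange ℚ_[2]).localTamagawaNumber ℤ_[2]) := by
  rintro ⟨h8, hc⟩
  set v : HeightOneSpectrum (𝓞 ℚ) := (primesEquiv (R := 𝓞 ℚ)).symm ⟨2, Nat.prime_two⟩ with hv
  haveI := perfectField_residueField_adicCompletionIntegers (K := ℚ) v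
  have hv2 : (primesEquiv v : ℕ) = 2 := by rw [hv, Equiv.apply_symm_apply]
  have hwild : W.wildConductorExponent v ≠ 0 :=
    (eight_dvd_conductorNorm_iff_wildConductorExponent_ne_zero W).mp (by norm_num at h8 ⊢; exact h8)
  have h3f : 3 ≤ W.conductorExponent v :=
    (W.three_le_conductorExponent_iff_wildConductorExponent_ne_zero v).mpr hwild
  by_cases hadd : W.HasAdditiveReductionAt v
  · have hc' : 3 ∣ (W.baseChange (v.adicCompletion ℚ)).localTamagawaNumber (v.adicCompletionIntegers ℚ) := by
      rw [← localTamagawaNumber_padic_eq_holds W v 2 hv2]; exact hc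
    have hK := CartanPlaceTwistLaw.kodairaSymbolAt_IV_or_IVstar_of_additive_of_three_dvd W v hadd hc'
    have h2mem : (2 : 𝓞 ℚ) ∈ v.asIdeal := by
      have := (natCast_mem_asIdeal_iff_eq_primesEquiv_symm v Nat.prime_two).mpr hv
      simpa using this
    exact hwild (W.wildConductorExponent_eq_zero_of_kodairaSymbolAt_IV_or_IVstar_two h2mem hK)
  · have h2 : ¬ 2 ≤ W.conductorExponent v := fun h ↦ hadd ((two_le_conductorExponent_iff_holds v W).mp h)
    omega

end Summit.BirchSwinnertonDyer.BirchSwinnertonDyer.Theorems.LeafNotWildTwoCarrier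

end
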